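import Summits.ResolutionOfSingularities.ResolutionOfSingularities.Theorems.PurelyInseparableDim4ChartClosureStrict
import Literature.AlgebraicGeometry.Resolution.StrictNormalCrossingsLabels
import Literature.AlgebraicGeometry.Resolution.RsopPartOfRegularSequence
import Literature.AlgebraicGeometry.Resolution.CanonicalResolutionSmoothCentre
import Literature.AlgebraicGeometry.Resolution.ExceptionalDivisorRegularGlobal
import Literature.AlgebraicGeometry.Resolution.BlowupChartMembership
import Literature.AlgebraicGeometry.Resolution.BlowupSNC
import Literature.AlgebraicGeometry.Resolution.MarkedIdealsArithmetic
import Literature.AlgebraicGeometry.Resolution.ProjectiveSpaceRegular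
import Literature.AlgebraicGeometry.Resolution.AlterationsLemma32
import HarnessLib

/-!
# Purely inseparable four-folds `z^p + F(x₁, …, x₄)`: the closure of an escaping chart centre has SIMPLE NORMAL
# CROSSINGS with the exceptional divisor — Q3 of the S3-glob question at depth 2, case `j ∉ S'`
# (brick S3-glob, part D2; cell `res-dim4-pi`, typ-2 g4)

[OURS · counted 0] (D-0157 DOOR 2; DR-157-C; desk WORD #97 (c); frame `PIDim4.TerminationImpliesOrderReduction`,
S3 (c)). Setting of `…ChartClosureStrict`: `π : W → 𝔸⁵_K` ANY blowing up along `V(z, x_S)`, `E₁ = V(𝓘Λ_S · 𝒪_W)` its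
exceptional divisor, `Y = V(J_Y)` the graph of A2/B1 (`j ∉ S'`), `T = V(St_π(𝒥_Y)) = Bl_{Y ∩ C} Y` the strict
transform = the global centre of the next coordinate centre (B2). PROVED here:

* §1 local algebra (Matsumura 14.2 through the tree's `exists_isRsopPart_append_span_eq`,
  `IsRsopPart.of_forall_mem_nonZeroDivisors`): `isRsopPart_empty`, `isRsopPart_single_of_saturated`,
  `exists_isRsopPart_labels_of_saturated` — in a regular local ring `R`, for an ideal `J` with `R/J` regular, an
  element `e ∈ 𝔪` which is `J`-SATURATED (`e a ∈ J ⇒ a ∈ J`) and such that `R/(J + (e))` is regular, there is a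
  part `z` of a regular system of parameters containing `e` and a set of its members generating `J`;
* §2 **`isRegular_subscheme_exceptional_comap_strictTransformIdeal_graph`** — `E₁ ∩ T` (scheme-theoretically:
  `V(𝓘_{E₁}|_T)`) is REGULAR: it is the exceptional divisor of the blow-up `T → Y` along the regular `Y ∩ C`
  (Liu 8.1.19 (b), tree `IsBlowup.isRegular_subscheme_comap`); `isRegular_subscheme_strictTransformIdeal_graph_sup`;
* §3 **`hasSNCWith_exceptional_strictTransformIdeal_graph`** — `HasSNCWith [𝓘_{E₁}] St_π(𝒥_Y)`, and
  **`hasSNCWith_transform_boundary_globalCentre_of_not_mem`** — Q3 of the signature of record for `j ∉ S'`: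
  `HasSNCWith (M.transform π 𝓘Λ_S).boundary Zc` for the root marked ideal `M = ((z^p+F)·𝒪, [], p)` (boundary
  `[E₁]`), from the ring reading and permissibility of `S'`.

With B2 (Q1) and D1 (Q2): for `j ∉ S'` the global centre of an arbitrary next coordinate centre is an ADMISSIBLE
BGMW centre on `W₁` (regular, inside the support, snc with `[E₁]`) — «FC-2 by closure» at depth 2, ‖ kernel.
Nothing here is a statement about resolution of singularities in dimension ≥ 4 / characteristic `p` (NOT proved
anywhere in this programme). bears_on: LADDER-RESOLUTION:D157-DOOR2 (res-dim4-pi). Supports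
stmt-ResolutionOfSingularities-16155 (helper, S3-glob D2).
-/

-- every declaration of this summit lives under `Summit.ResolutionOfSingularities.ResolutionOfSingularities`
-- (summit = problem), which the duplicate-namespace linter flags; house convention (cf. the Target file).
set_option linter.dupNamespace false

noncomputable section

open MvPolynomial Finset CategoryTheory AlgebraicGeometry Opposite TopologicalSpace IsLocalRing
open AlgebraicGeometry.Scheme.IdealSheafData (ofIdealTop vanishingIdeal)

namespace Summit.ResolutionOfSingularities.ResolutionOfSingularities.Theorems.PIDim4

open Literature.AlgebraicGeometry.Resolution
open Literature.AlgebraicGeometry.Resolution.AffinePointBlowup (P A γ coord Wtop ξ)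

namespace ChartDictionary

/-! ## §1 Local algebra: a saturated element joins the generators of a regular quotient in a system of parameters -/

section Local

variable {R : Type} [CommRing R]

/-- The empty family is part of a regular system of parameters of a regular local ring. -/
theorem isRsopPart_empty [IsRegularLocalRing R] (z : Fin 0 → R) : IsRsopPart z := by
  obtain ⟨u, hu⟩ := exists_regularSystemOfParameters (R := R)
  refine ⟨inferInstance, (maximalIdeal R).spanFinrank, u, ?_, ?_⟩
  · rw [Nat.zero_add]
    exact (IsRegularLocalRing.spanFinrank_maximalIdeal (R := R)).symm
  · rw [Set.range_eq_empty z, Set.empty_union, hu]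

/-- Saturation of `⋃ₙ (L : eⁿ)` (the stalk of a strict transform): `e · a ∈ ⋃ₙ (L : eⁿ) ⇒ a ∈ ⋃ₙ (L : eⁿ)`. -/
theorem mem_iSup_colon_span_pow_of_mul_mem_left (L : Ideal R) (e a : R)
    (h : e * a ∈ ⨆ n : ℕ, Submodule.colon L ((Ideal.span {e} ^ n : Ideal R) : Set R)) :
    a ∈ ⨆ n : ℕ, Submodule.colon L ((Ideal.span {e} ^ n : Ideal R) : Set R) := by
  have hdir : Directed (· ≤ ·)
      (fun n : ℕ => Submodule.colon L ((Ideal.span {e} ^ n : Ideal R) : Set R)) :=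
    Monotone.directed_le fun m n hmn =>
      Submodule.colon_mono le_rfl (SetLike.coe_subset_coe.mpr (Ideal.pow_le_pow_right hmn))
  obtain ⟨N, hN⟩ := (Submodule.mem_iSup_of_directed _ hdir).mp h
  refine (Submodule.mem_iSup_of_directed _ hdir).mpr ⟨N + 1, ?_⟩
  rw [Ideal.span_singleton_pow, Submodule.mem_colon] at hN ⊢
  intro s hs
  obtain ⟨d, rfl⟩ := Ideal.mem_span_singleton'.mp hs
  have h1 := hN (d * e ^ N) (Ideal.mem_span_singleton'.mpr ⟨d, rfl⟩)
  rw [smul_eq_mul] at h1 ⊢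
  have : a * (d * e ^ (N + 1)) = e * a * (d * e ^ N) := by ring
  rw [this]
  exact h1

/-- **The image of a `J`-saturated element of `𝔪` is a regular parameter of `R/J`** when `R/(J + (e))` is regular:
`(ē)` is part of a regular system of parameters of the (regular) local ring `R/J`. -/
theorem isRsopPart_single_of_saturated [IsLocalRing R] [IsNoetherianRing R] {J : Ideal R}
    [IsRegularLocalRing (R ⧸ J)] {e : R} (he : e ∈ maximalIdeal R) (hsat : ∀ a : R, e * a ∈ J → a ∈ J)
    (hreg : IsRegularLocalRing (R ⧸ (J ⊔ Ideal.span {e}))) :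
    IsRsopPart (Ideal.Quotient.mk J ∘ (fun _ : Fin 1 => e)) := by
  haveI : Nontrivial (R ⧸ J) := inferInstance
  have hrange : Set.range (Ideal.Quotient.mk J ∘ fun _ : Fin 1 => e) = {Ideal.Quotient.mk J e} := by
    ext x
    simp only [Set.mem_range, Function.comp_apply, Set.mem_singleton_iff, exists_const]
    exact eq_comm
  -- `(R/J)/(ē) ≅ R/(J + (e))` is regular
  haveI : IsRegularLocalRing ((R ⧸ J) ⧸ Ideal.span (Set.range (Ideal.Quotient.mk J ∘ fun _ : Fin 1 => e))) := by
    rw [hrange]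
    have hmap : (Ideal.span {e} : Ideal R).map (Ideal.Quotient.mk J) = Ideal.span {Ideal.Quotient.mk J e} := by
      rw [Ideal.map_span, Set.image_singleton]
    rw [← hmap]
    exact IsRegularLocalRing.of_ringEquiv (DoubleQuot.quotQuotEquivQuotSup J (Ideal.span {e})).symm
  refine IsRsopPart.of_forall_mem_nonZeroDivisors (fun _ => ?_) (fun i => ?_)
  · -- `ē ∈ 𝔪_{R/J}`
    haveI : IsLocalHom (Ideal.Quotient.mk J) := IsLocalHom.of_surjective _ Ideal.Quotient.mk_surjective
    exact map_nonunit (Ideal.Quotient.mk J) e he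
  · -- `ē` is a non-zero-divisor of `R/J` (modulo the empty family of its predecessors)
    have hempty : ((Ideal.Quotient.mk J ∘ fun _ : Fin 1 => e) '' {j : Fin 1 | (j : ℕ) < (i : ℕ)}) = ∅ := by
      ext x
      simp only [Set.mem_image, Set.mem_setOf_eq, Set.mem_empty_iff_false, iff_false, not_exists, not_and]
      intro j hj
      exact absurd hj (by have := Fin.val_eq_zero j; have := Fin.val_eq_zero i; omega)
    rw [hempty, Ideal.span_empty]
    refine mem_nonZeroDivisors_iff_right.mpr fun x hx => ?_
    obtain ⟨y, rfl⟩ := Ideal.Quotient.mk_surjective x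
    obtain ⟨a, rfl⟩ := Ideal.Quotient.mk_surjective y
    rw [Function.comp_apply, ← map_mul, ← map_mul, Ideal.Quotient.eq_zero_iff_mem, Ideal.mem_bot,
      Ideal.Quotient.eq_zero_iff_mem, mul_comm] at hx
    rw [Ideal.Quotient.eq_zero_iff_mem, Ideal.mem_bot, Ideal.Quotient.eq_zero_iff_mem]
    exact hsat a hx

/-- **Labelled rsop-part data at a point of `T ∩ E`.** In a regular (Noetherian) local ring `R`: for an ideal `J`
with `R/J` regular and a `J`-saturated `e ∈ 𝔪` with `R/(J + (e))` regular, there are a part `z : Fin m → R` of a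
regular system of parameters, an index `i₀` with `z i₀ = e` and a set `S` of indices with `J = (z_i : i ∈ S)`. -/
theorem exists_isRsopPart_labels_of_saturated [IsRegularLocalRing R] {J : Ideal R} [IsRegularLocalRing (R ⧸ J)]
    {e : R} (he : e ∈ maximalIdeal R) (hsat : ∀ a : R, e * a ∈ J → a ∈ J)
    (hreg : IsRegularLocalRing (R ⧸ (J ⊔ Ideal.span {e}))) :
    ∃ (m : ℕ) (z : Fin m → R) (i₀ : Fin m) (S : Set (Fin m)),
      IsRsopPart z ∧ z i₀ = e ∧ Ideal.span (z '' S) = J := by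
  obtain ⟨r, c, -, hz, hspan⟩ := exists_isRsopPart_append_span_eq (J := J) (a := (Fin.elim0 : Fin 0 → R))
    (b := fun _ : Fin 1 => e) (isRsopPart_empty _) (fun k => k.elim0) (fun _ => he)
    (isRsopPart_single_of_saturated he hsat hreg)
  refine ⟨0 + r + 1, Fin.append (Fin.append Fin.elim0 c) (fun _ : Fin 1 => e), Fin.natAdd (0 + r) 0,
    Set.range (Fin.castAdd 1), hz, ?_, ?_⟩
  · rw [Fin.append_right]
  · rw [← Set.range_comp, ← hspan]
    congr 1
    ext x
    simp only [Set.mem_range, Function.comp_apply, Fin.append_left]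

end Local


/-! ## §2 `E₁ ∩ T` is regular: the exceptional divisor of `Bl_{Y ∩ C} Y` -/

section Scheme

variable {K : Type} [Field K] {p : ℕ} {S S' : Finset (Fin 4)} {j : Fin 4} {b : Fin 4 → K}
  {Θ : A 4 K ≃ₐ[K] A 4 K} {h : MvPolynomial (Fin 4) K} {F F₁ : MvPolynomial (Fin 4) K}
  {W : Scheme.{0}} {π : W ⟶ P 4 K}

/-- **`V(𝓘_{E₁}|_T)` is regular**: the exceptional ideal restricted to the strict transform `T = V(St_π(𝒥_Y))` cuts
out the exceptional divisor of the blow-up `T → Y` along the regular `Y ∩ V(z, x_S)` (Stacks 080E), regular by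
Liu 8.1.19 (b). -/
theorem isRegular_subscheme_exceptional_comap_strictTransformIdeal_graph (hj : j ∈ S) (hjS' : j ∉ S')
    (hπ : IsBlowup π (AffineCoordBlowup.𝓘Λ 4 K (insert 0 (Fin.succ '' (S : Set (Fin 4))))))
    {H : MvPolynomial (Fin 4) K} (hHS : H ∈ Ideal.span (X '' (S : Set (Fin 4)) : Set (MvPolynomial (Fin 4) K))) :
    Scheme.IsRegular (((AffineCoordBlowup.𝓘Λ 4 K (insert 0 (Fin.succ '' (S : Set (Fin 4))))).comap π).comap
      (strictTransformIdeal π (AffineCoordBlowup.𝓘Λ 4 K (insert 0 (Fin.succ '' (S : Set (Fin 4)))))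
        (Hironaka2005.idealSheafOf (Ideal.span (insert (X 0 - rename Fin.succ H)
          (((fun k : Fin 4 => (X k.succ - C (b k) : A 4 K)) '' ((S' \ S : Finset (Fin 4)) : Set (Fin 4))) ∪
           ((fun i : Fin 4 => (X i.succ - C (b i) * X j.succ : A 4 K)) '' ((S' ∩ S : Finset (Fin 4)) : Set (Fin 4)))))))).subschemeι).subscheme := by
  set C₀ := AffineCoordBlowup.𝓘Λ 4 K (insert 0 (Fin.succ '' (S : Set (Fin 4)))) with hC₀
  set 𝒥 := Hironaka2005.idealSheafOf (Ideal.span (insert (X 0 - rename Fin.succ H)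
          (((fun k : Fin 4 => (X k.succ - C (b k) : A 4 K)) '' ((S' \ S : Finset (Fin 4)) : Set (Fin 4))) ∪
           ((fun i : Fin 4 => (X i.succ - C (b i) * X j.succ : A 4 K)) '' ((S' ∩ S : Finset (Fin 4)) : Set (Fin 4))))))
    with h𝒥
  haveI : IsLocallyNoetherian 𝒥.subscheme := LocallyOfFiniteType.isLocallyNoetherian 𝒥.subschemeι
  have hbl := isBlowup_lift_subschemeι_strictTransformIdeal hπ 𝒥.subschemeι
  have hregY : Scheme.IsRegular 𝒥.subscheme := isRegular_subscheme_graph (S := S) hjS' b H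
  have hregC : Scheme.IsRegular (C₀.comap 𝒥.subschemeι).subscheme := by
    have heq : (𝒥 ⊔ C₀).comap 𝒥.subschemeι = C₀.comap 𝒥.subschemeι := by
      rw [(Scheme.IdealSheafData.map_gc 𝒥.subschemeι).l_sup, comap_subschemeι_self, bot_sup_eq]
    rw [← heq, isRegular_subscheme_comap_subschemeι_iff 𝒥 le_sup_left]
    exact isRegular_subscheme_graph_sup (S' := S') hj b hHS
  have hreg := hbl.isRegular_subscheme_comap hregY hregC
  rw [← Scheme.IdealSheafData.comap_comp, IsClosedImmersion.lift_fac, Scheme.IdealSheafData.comap_comp,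
    Scheme.IdealSheafData.ker_subschemeι] at hreg
  exact hreg

/-- **`V(St_π(𝒥_Y) + 𝓘_{E₁})` is regular** (the same closed subscheme `E₁ ∩ T`, as a subscheme of `W`). -/
theorem isRegular_subscheme_strictTransformIdeal_graph_sup (hj : j ∈ S) (hjS' : j ∉ S')
    (hπ : IsBlowup π (AffineCoordBlowup.𝓘Λ 4 K (insert 0 (Fin.succ '' (S : Set (Fin 4))))))
    {H : MvPolynomial (Fin 4) K} (hHS : H ∈ Ideal.span (X '' (S : Set (Fin 4)) : Set (MvPolynomial (Fin 4) K))) :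
    Scheme.IsRegular (strictTransformIdeal π (AffineCoordBlowup.𝓘Λ 4 K (insert 0 (Fin.succ '' (S : Set (Fin 4)))))
        (Hironaka2005.idealSheafOf (Ideal.span (insert (X 0 - rename Fin.succ H)
          (((fun k : Fin 4 => (X k.succ - C (b k) : A 4 K)) '' ((S' \ S : Finset (Fin 4)) : Set (Fin 4))) ∪
           ((fun i : Fin 4 => (X i.succ - C (b i) * X j.succ : A 4 K)) '' ((S' ∩ S : Finset (Fin 4)) : Set (Fin 4))))))) ⊔
      (AffineCoordBlowup.𝓘Λ 4 K (insert 0 (Fin.succ '' (S : Set (Fin 4))))).comap π).subscheme := by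
  set St := strictTransformIdeal π (AffineCoordBlowup.𝓘Λ 4 K (insert 0 (Fin.succ '' (S : Set (Fin 4)))))
        (Hironaka2005.idealSheafOf (Ideal.span (insert (X 0 - rename Fin.succ H)
          (((fun k : Fin 4 => (X k.succ - C (b k) : A 4 K)) '' ((S' \ S : Finset (Fin 4)) : Set (Fin 4))) ∪
           ((fun i : Fin 4 => (X i.succ - C (b i) * X j.succ : A 4 K)) '' ((S' ∩ S : Finset (Fin 4)) : Set (Fin 4)))))))
    with hSt
  set 𝓔 := (AffineCoordBlowup.𝓘Λ 4 K (insert 0 (Fin.succ '' (S : Set (Fin 4))))).comap π with h𝓔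
  have heq : (St ⊔ 𝓔).comap St.subschemeι = 𝓔.comap St.subschemeι := by
    rw [(Scheme.IdealSheafData.map_gc St.subschemeι).l_sup, comap_subschemeι_self, bot_sup_eq]
  rw [← isRegular_subscheme_comap_subschemeι_iff St le_sup_left, heq]
  exact isRegular_subscheme_exceptional_comap_strictTransformIdeal_graph (S' := S') hj hjS' hπ hHS

/-! ## §3 Q3: simple normal crossings with the exceptional divisor -/

/-- **`HasSNCWith [𝓘_{E₁}] St_π(𝒥_Y)`** — the strict transform of the graph has simple normal crossings with the
exceptional divisor: at each point of `W` the local equation `e` of `E₁` (an effective Cartier divisor) and local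
generators of `T` form part of ONE regular system of parameters (`T`, `E₁`, `E₁ ∩ T` regular; the stalk of a strict
transform is `e`-saturated). -/
theorem hasSNCWith_exceptional_strictTransformIdeal_graph (hj : j ∈ S) (hjS' : j ∉ S')
    (hπ : IsBlowup π (AffineCoordBlowup.𝓘Λ 4 K (insert 0 (Fin.succ '' (S : Set (Fin 4))))))
    {H : MvPolynomial (Fin 4) K} (hHS : H ∈ Ideal.span (X '' (S : Set (Fin 4)) : Set (MvPolynomial (Fin 4) K))) :
    HasSNCWith [(AffineCoordBlowup.𝓘Λ 4 K (insert 0 (Fin.succ '' (S : Set (Fin 4))))).comap π]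
      (strictTransformIdeal π (AffineCoordBlowup.𝓘Λ 4 K (insert 0 (Fin.succ '' (S : Set (Fin 4)))))
        (Hironaka2005.idealSheafOf (Ideal.span (insert (X 0 - rename Fin.succ H)
          (((fun k : Fin 4 => (X k.succ - C (b k) : A 4 K)) '' ((S' \ S : Finset (Fin 4)) : Set (Fin 4))) ∪
           ((fun i : Fin 4 => (X i.succ - C (b i) * X j.succ : A 4 K)) '' ((S' ∩ S : Finset (Fin 4)) : Set (Fin 4)))))))) := by
  set C₀ := AffineCoordBlowup.𝓘Λ 4 K (insert 0 (Fin.succ '' (S : Set (Fin 4)))) with hC₀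
  set St := strictTransformIdeal π C₀
        (Hironaka2005.idealSheafOf (Ideal.span (insert (X 0 - rename Fin.succ H)
          (((fun k : Fin 4 => (X k.succ - C (b k) : A 4 K)) '' ((S' \ S : Finset (Fin 4)) : Set (Fin 4))) ∪
           ((fun i : Fin 4 => (X i.succ - C (b i) * X j.succ : A 4 K)) '' ((S' ∩ S : Finset (Fin 4)) : Set (Fin 4)))))))
    with hSt
  set 𝓔 := C₀.comap π with h𝓔
  haveI : IsProper π := hπ.isProper
  haveI : IsLocallyNoetherian W := LocallyOfFiniteType.isLocallyNoetherian π
  -- `W`, `𝔸⁵`, `T`, `E₁`, `E₁ ∩ T` are regular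
  have hW : Scheme.IsRegular W := by
    haveI := AffineCoordBlowup.smooth_comp hπ
    exact Scheme.IsRegular.of_smooth (π ≫ AffinePointBlowup.f 4 K) (Scheme.isRegular_Spec (CommRingCat.of K))
  have hP : Scheme.IsRegular (P 4 K) := by
    haveI := AffinePointBlowup.smooth_f 4 K
    exact Scheme.IsRegular.of_smooth (AffinePointBlowup.f 4 K) (Scheme.isRegular_Spec (CommRingCat.of K))
  have hT : Scheme.IsRegular St.subscheme := isRegular_subscheme_strictTransformIdeal_graph (S' := S') hj hjS' hπ hHS
  have hE : Scheme.IsRegular 𝓔.subscheme :=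
    hπ.isRegular_subscheme_comap hP (Literature.AlgebraicGeometry.Hironaka2017.Lib.AffineCoordBlowupLSB.isRegular_CΛ 4 K _)
  have hTE : Scheme.IsRegular (St ⊔ 𝓔).subscheme :=
    isRegular_subscheme_strictTransformIdeal_graph_sup (S' := S') hj hjS' hπ hHS
  refine hasSNCWith_of_isRsopPart_labels _ _ fun w => ?_
  haveI : IsRegularLocalRing (W.presheaf.stalk w) := hW w
  obtain ⟨e, he0, hEe⟩ := hπ.isEffectiveCartier.exists_stalkIdeal_eq_span w
  -- a boundary member through `w` is `E₁` itself
  have hD : ∀ D : {D : W.IdealSheafData // D ∈ [𝓔] ∧ w ∈ D.support}, D.1 = 𝓔 := fun D =>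
    List.mem_singleton.mp D.2.1
  have hinj : ∀ {m : ℕ} (i₀ : Fin m),
      Function.Injective (fun _ : {D : W.IdealSheafData // D ∈ [𝓔] ∧ w ∈ D.support} => i₀) :=
    fun i₀ D₁ D₂ _ => Subtype.ext ((hD D₁).trans (hD D₂).symm)
  -- the exceptional equation `e` is saturated for the stalk of the strict transform
  have hsat : ∀ a, e * a ∈ stalkIdeal St w → a ∈ stalkIdeal St w := by
    intro a ha
    rw [hSt, stalkIdeal_strictTransformIdeal, ← h𝓔, hEe] at ha ⊢
    exact mem_iSup_colon_span_pow_of_mul_mem_left _ e a ha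
  by_cases hwE : w ∈ 𝓔.support
  · -- `w ∈ E₁`: `e ∈ 𝔪_w`
    have he : e ∈ maximalIdeal (W.presheaf.stalk w) := by
      have h1 := (mem_support_iff_stalkIdeal_le 𝓔 w).mp hwE
      rw [hEe] at h1
      exact h1 (Ideal.mem_span_singleton_self e)
    by_cases hwT : w ∈ St.support
    · -- point of `T ∩ E₁`
      haveI := isRegularLocalRing_stalk_quotient_stalkIdeal hT hwT
      have hreg2 : IsRegularLocalRing (W.presheaf.stalk w ⧸ (stalkIdeal St w ⊔ Ideal.span {e})) := by
        rw [← hEe, ← stalkIdeal_sup]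
        exact isRegularLocalRing_stalk_quotient_stalkIdeal hTE
          (by rw [Scheme.IdealSheafData.support_sup]; exact ⟨hwT, hwE⟩)
      obtain ⟨m, z, i₀, Sset, hz, hzi, hzS⟩ := exists_isRsopPart_labels_of_saturated he hsat hreg2
      refine ⟨m, z, hz, ⟨fun _ => i₀, hinj i₀, fun D => ?_⟩, fun _ => ⟨Sset, hzS.symm⟩⟩
      rw [hD D, hEe, hzi]
    · -- point of `E₁` off `T`: the same lemma with `J = 0`
      haveI : IsRegularLocalRing (W.presheaf.stalk w ⧸ (⊥ : Ideal (W.presheaf.stalk w))) :=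
        IsRegularLocalRing.of_ringEquiv (RingEquiv.quotientBot (W.presheaf.stalk w)).symm
      have hsat0 : ∀ a, e * a ∈ (⊥ : Ideal (W.presheaf.stalk w)) → a ∈ (⊥ : Ideal (W.presheaf.stalk w)) := by
        intro a ha
        rw [Ideal.mem_bot] at ha ⊢
        exact (mem_nonZeroDivisors_iff_right.mp he0) a (by rw [mul_comm]; exact ha)
      have hreg1 : IsRegularLocalRing (W.presheaf.stalk w ⧸ ((⊥ : Ideal (W.presheaf.stalk w)) ⊔ Ideal.span {e})) := by
        rw [bot_sup_eq, ← hEe]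
        exact isRegularLocalRing_stalk_quotient_stalkIdeal hE hwE
      obtain ⟨m, z, i₀, Sset, hz, hzi, -⟩ := exists_isRsopPart_labels_of_saturated he hsat0 hreg1
      exact ⟨m, z, hz, ⟨fun _ => i₀, hinj i₀, fun D => by rw [hD D, hEe, hzi]⟩, fun h => (hwT h).elim⟩
  · -- `w ∉ E₁`: no boundary member through `w`
    have hnoD : ∀ D : {D : W.IdealSheafData // D ∈ [𝓔] ∧ w ∈ D.support}, False := fun D =>
      hwE ((hD D) ▸ D.2.2)
    by_cases hwT : w ∈ St.support
    · haveI := isRegularLocalRing_stalk_quotient_stalkIdeal hT hwT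
      obtain ⟨u, hu, Sset, hS⟩ := exists_rsop_of_isRegularLocalRing_quotient
        ((mem_support_iff_stalkIdeal_le St w).mp hwT)
      have huz : IsRsopPart (u ∘ id) := isRsopPart_comp_of_rsop rfl u hu id Function.injective_id
      exact ⟨_, u, huz, ⟨fun D => (hnoD D).elim, fun D => (hnoD D).elim, fun D => (hnoD D).elim⟩,
        fun _ => ⟨Sset, hS⟩⟩
    · exact ⟨0, Fin.elim0, isRsopPart_empty _, ⟨fun D => (hnoD D).elim, fun D => (hnoD D).elim,
        fun D => (hnoD D).elim⟩, fun h => (hwT h).elim⟩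

/-- **Q3 OF THE S3-GLOB QUESTION, case `j ∉ S'`.** With the ring reading of the chart dictionary and `S' ∌ j`
permissible for `F₁`: the global centre `Zc = 𝓘(closure φ(V(z, x_{S'})))` has simple normal crossings with the
boundary `[E₁]` of the transformed root marked ideal `((z^p + F)·𝒪, [], p).transform π 𝓘Λ_S`. -/
theorem hasSNCWith_transform_boundary_globalCentre_of_not_mem [Fact p.Prime] [CharP K p] (hj : j ∈ S)
    (hjS' : j ∉ S') (hbj : b j = 0) (h0 : Θ (X 0) = X 0 + rename Fin.succ h)
    (hs : ∀ i : Fin 4, Θ (X i.succ) = X i.succ + C (b i))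
    (hπ : IsBlowup π (AffineCoordBlowup.𝓘Λ 4 K (insert 0 (Fin.succ '' (S : Set (Fin 4))))))
    (hperm : (p : ℕ∞) ≤ CentreBlowup.ordAlong S F)
    (hread : Θ (coordBlowupSubst K (insert 0 (Fin.succ '' (S : Set (Fin 4)))) j.succ (hyp p F)) =
      X j.succ ^ p * hyp p F₁)
    (hperm' : (p : ℕ∞) ≤ CentreBlowup.ordAlong S' F₁) :
    haveI : IsIso (CommRingCat.ofHom (Θ : A 4 K →+* A 4 K)) :=
      (inferInstance : IsIso Θ.toRingEquiv.toCommRingCatIso.hom)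
    HasSNCWith
      ((⟨hypSheaf p F, [], p⟩ : MarkedIdeal (P 4 K)).transform π
        (AffineCoordBlowup.𝓘Λ 4 K (insert 0 (Fin.succ '' (S : Set (Fin 4)))))).boundary
      (vanishingIdeal (closureImage
        (Spec.map (CommRingCat.ofHom (Θ : A 4 K →+* A 4 K)) ≫ AffineCoordBlowup.chartImm hπ (succ_mem_centreVars hj))
        ((AffineCoordBlowup.𝓘Λ 4 K (insert 0 (Fin.succ '' (S' : Set (Fin 4))))).support : Set (P 4 K)))) := by
  obtain ⟨H, hH⟩ := exists_lift_twist hj hbj h0 hs hperm hread hperm'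
  rw [MarkedIdeal.transform_boundary, List.map_nil, List.nil_append,
    ← strictTransformIdeal_graph_eq_globalCentre hj hjS' hbj h0 hs hπ hH]
  exact hasSNCWith_exceptional_strictTransformIdeal_graph (S' := S') hj hjS' hπ (mem_span_X_of_lift hj hH)

end Scheme

end ChartDictionary

end Summit.ResolutionOfSingularities.ResolutionOfSingularities.Theorems.PIDim4

end
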